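import Summits.QuantumFields.YangMills.Theorems.IR.AfPincerUcSharpOnset
import Summits.QuantumFields.YangMills.Theorems.BalabanLadderIROnsetOfSingleCell
import HarnessLib

/-!
# Crux `IR` (stmt-QuantumFields-19354), line `af-pincer-Uc`: SHARP supplier-side reductions — the hypotheses of the tree reductions
# `SupplierSC.onsetMixingTypicalUKPcSC_of_workingClassSC` (p524177) and `SingleCell.onsetMixingTypicalUKPcSC_of_singleCellWorkingClassSC` (p526714)
# delivered at a mesh `b` with `a β · b < T(δ)` give I♯_SC and hence `IR|SC` with NO X-stub

SOURCE TEXT: crux-plan desk `ym-cplan-19354-af-pincer` port rev 2 `pub/ym-beyond/ym-cplan-19354-af-pincer/port/AfPincerUcSharpOnset.lean`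
sha16 71577857bd55b2bd (owner filing map R99, 2026-08-27T11:42:46Z).  Helper module for item `stmt-QuantumFields-19354`
(`--supports stmt-QuantumFields-19354 --as helper`; it closes nothing).

Binders `a`, `LowerBounds G r a` in scope; `δ` BEFORE `T, β₂` (a δ-independent mesh collapses to the universal currency: `SharpOnset.univOnsetSharpSC_of_deltaUniform`).
* (6a) `ClauseIAndRaritySharpSC` — a frame-covariant cell-local family with clause (i) at the centre + any-exterior single-cell rarity `δ` at a sharp mesh —
  `⇒ OnsetSharpUKPcSC` (`Supplier.typShellCondUKPc_of_covariant_supCellRarity` frame by frame, mirror constant bridged) `⇒ IR` given `IRNSC`.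
* (6b) `WorkingClassSharpSC` — the working class `diluteTyp ∩ Typ_lx^int` (`frameCovariant_workingClass`, `typLocal_workingClass`) — `⇒` (6a) `⇒ IR`.
* (6c) `SingleCellSharpSC` — lane A's single-shell-cell influence `≤ ε / shellCount n` at a sharp mesh — `⇒` (6b) (`SingleCell.clauseI_of_singleShellCellInfluence`,
  `card_shell`) `⇒ IR`.
* (6d-wc) `ir_of_activitySupplierSharpSC` — the relativised blocked-activity supplier with class = the working class: ANY activity predicate `Act`, an adapter
  `Act … Typ → ClauseI … Typ`, a sharp construction statement ⇒ `IR|SC`.  (Hereditary, class-free form: `SharpOnset.ir_of_activitySupplierHereditarySharpSC`.)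

PLACEMENT (ctriage-1 located objection O-107, S91 870971a55b69c8b5): the working class of record is KERNEL-INVISIBLE (`ClauseI (WorkingClass …) ↔ ClauseI univ`
for budget-admissible `ℓ ≤ 16`, rigorous modulo typing) and a class whose rarity is certified for EVERY exterior (`SupCellRarityAt`) cannot constrain the boundary
layer the kernel reads — so (6a)–(6d-wc) are correct reductions whose CONTENT is that of the universal sharp currency `SharpOnset.UnivOnsetSharpSC` (exposed:
`SharpOnset.not_univOnsetSharpSC_of_uniformWire`).  They are filed as the typed record of what the supplier architecture of record delivers at a sharp mesh.

HONEST FRAMING: typed statements and implications among OPEN statements (plus negatives MODULO an unconstructed wire or an onset-divergence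
hypothesis) for stubs of a CONDITIONAL chain; nothing here proves weak-coupling mixing or a gap; not Clay.  No `sorry`; axioms ⊆ {propext,
Classical.choice, Quot.sound}.
-/

set_option autoImplicit false

noncomputable section

open Filter Topology MeasureTheory
open scoped SchwartzMap
open Literature.MathematicalPhysics.QuantumFieldTheory Literature.MathematicalPhysics.QuantumLattice
open Summit.QuantumFields.YangMills.Cruxes.OSLegsFromFemtoAndGap.DlrCollarTransfer (GapInUnits LowerBounds Q2)
open Summit.QuantumFields.YangMills.Cruxes.IR.OnsetFormats (shellCount UnivShellCond)

namespace Summit.QuantumFields.YangMills.Cruxes.IR.AfPincerUc.SharpOnset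

open Summit.QuantumFields.YangMills.Cruxes.IR.AfPincerUc
open Literature.Probability.LatticeModels
open Summit.QuantumFields.YangMills.Cruxes.IR.FixedMesh (ClauseI)
open Summit.QuantumFields.YangMills.Cruxes.IR.Tempered (cellEdges windowCells regionEdges)
open Summit.QuantumFields.YangMills.Cruxes.IR.ShellTempered (windowCellsPlus)
open Summit.QuantumFields.YangMills.Theorems.IRTypLocalExcess (FrameCovariant WorkingClass frameCovariant_workingClass
  typLocal_workingClass)
open Summit.QuantumFields.YangMills.Cruxes.IR.AfPincerUc.Supplier (SupCellRarityAt typShellCondUKPc_of_covariant_supCellRarity)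
open Summit.QuantumFields.YangMills.Cruxes.IR.AfPincerUc.SingleCell (clauseI_of_singleShellCellInfluence card_shell)


/-! ## (6a) clause (i) + any-exterior single-cell rarity at a sharp mesh -/

/-- **(6a) «clause (i) + single-cell any-exterior rarity AT A SHARP MESH» (SC family, ARCH-AE currency).**  For every simply connected
compact simple `G`, `r`, and positive unit map `a → 0` with `LowerBounds G r a`: admissible `(n, ε)` and, for every budget `δ > 0`, a window
`T` such that for all large `β` SOME mesh `b ≥ 1` with `a β · b < T` carries a frame-covariant family, cell-local on every mesh-`b` frame,
with clause (i) at the centre and any-exterior single-cell rarity `δ`. -/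
def ClauseIAndRaritySharpSC : Prop :=
  ∀ (G : Type) [Group G] [TopologicalSpace G] [IsTopologicalGroup G] [CompactSpace G],
    IsCompactSimpleLieGroup G → SimplyConnectedSpace G →
    letI : MeasurableSpace G := borel G; haveI : BorelSpace G := ⟨rfl⟩;
    ∀ (r : LatticeRep G) (a : ℝ → ℝ), (∀ β, 0 < a β) → Tendsto a atTop (𝓝 0) → LowerBounds G r a →
      ∃ (n : ℕ) (ε : ℝ), 1 ≤ n ∧ 0 ≤ ε ∧ ε * OnsetFormats.shellCount n ≤ 3 / 4 ∧
        ∀ δ : ℝ, 0 < δ → ∃ T β₂ : ℝ, ∀ β : ℝ, β₂ ≤ β → ∃ b : ℕ, 1 ≤ b ∧ a β * (b : ℝ) < T ∧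
          ∃ Typ : (Fin 4 → ℤ → ℤ) → (Fin 4 → ℤ) → Set (LGConfig 4 G), FrameCovariant Typ ∧
            ∀ w : Fin 4 → ℤ → ℤ, OnsetFormatsUc.IsFrame b w →
              OnsetFormatsUc.TypLocal w (Typ w) ∧ ClauseI r.ρ β w n ε (Typ w) ∧ SupCellRarityAt r.ρ β w (Typ w) δ

/-- **(6a) ⇒ I♯_SC (PROVED)** — `Supplier.typShellCondUKPc_of_covariant_supCellRarity` frame by frame, mirror constant bridged. -/
theorem onsetSharpUKPcSC_of_clauseIAndRaritySharpSC (h : ClauseIAndRaritySharpSC) : OnsetSharpUKPcSC := by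
  intro G _ _ _ _ hG hsc
  letI : MeasurableSpace G := borel G
  haveI : BorelSpace G := ⟨rfl⟩
  intro r a ha hat hlb
  haveI : T2Space G := T2Space.of_injective_continuous r.injective r.continuous
  haveI : SecondCountableTopology G :=
    (r.continuous.isClosedEmbedding r.injective).isEmbedding.secondCountableTopology
  obtain ⟨n, ε, hn, hε, hM, hrest⟩ := h G hG hsc r a ha hat hlb
  refine ⟨n, ε, hn, hε, hM, fun δ hδ => ?_⟩
  obtain ⟨T, β₂, hβ⟩ := hrest δ hδ
  refine ⟨T, β₂, fun β hb => ?_⟩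
  obtain ⟨b, hb1, hlt, Typ, hcov, hw⟩ := hβ β hb
  exact ⟨b, hb1, hlt, (typShellCondUKPc_iff_mirror r.ρ β b n ε δ).mpr
    (typShellCondUKPc_of_covariant_supCellRarity r.continuous β hb1 hδ.le hcov hw)⟩

/-- **(6a) ∧ R_NSC ⇒ IR (PROVED, E discharged, no X).** -/
theorem ir_of_clauseIAndRaritySharpSC (h : ClauseIAndRaritySharpSC) (hN : IRNSC) :
    Summit.QuantumFields.YangMills.Theses.BalabanLadder.IR :=
  ir_of_onsetSharpSC (onsetSharpUKPcSC_of_clauseIAndRaritySharpSC h) hN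


/-! ## (6b) the working class at a sharp mesh -/

/-- **(6b) Working-class form at a sharp mesh**: clause (i) for `WorkingClass = diluteTyp ∩ Typ_lx^int` with β-, δ-dependent parameters
`(ℓ, T', Rs, E)` and its any-exterior single-cell rarity `δ` (= the explicit inequality `workingBudget ≤ δ` of
`Theorems/BalabanLadderIRWorkingClassBudget`), on every mesh-`b` frame, at a mesh with `a β · b < T(δ)`. -/
def WorkingClassSharpSC : Prop :=
  ∀ (G : Type) [Group G] [TopologicalSpace G] [IsTopologicalGroup G] [CompactSpace G],
    IsCompactSimpleLieGroup G → SimplyConnectedSpace G →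
    letI : MeasurableSpace G := borel G; haveI : BorelSpace G := ⟨rfl⟩;
    ∀ (r : LatticeRep G) (a : ℝ → ℝ), (∀ β, 0 < a β) → Tendsto a atTop (𝓝 0) → LowerBounds G r a →
      ∃ (n : ℕ) (ε : ℝ), 1 ≤ n ∧ 0 ≤ ε ∧ ε * OnsetFormats.shellCount n ≤ 3 / 4 ∧
        ∀ δ : ℝ, 0 < δ → ∃ T β₂ : ℝ, ∀ β : ℝ, β₂ ≤ β → ∃ b : ℕ, 1 ≤ b ∧ a β * (b : ℝ) < T ∧
          ∃ (ℓ : ℕ) (T' : ℝ) (Rs : Set ℕ) (E : ℕ → ℝ), ∀ w : Fin 4 → ℤ → ℤ, OnsetFormatsUc.IsFrame b w →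
            ClauseI r.ρ β w n ε (WorkingClass r.ρ ℓ T' Rs E w) ∧
              SupCellRarityAt r.ρ β w (WorkingClass r.ρ ℓ T' Rs E w) δ

/-- **(6b) ⇒ (6a) (PROVED)** — witness family = the working class (`frameCovariant_workingClass`, `typLocal_workingClass`). -/
theorem clauseIAndRaritySharpSC_of_workingClassSharpSC (h : WorkingClassSharpSC) : ClauseIAndRaritySharpSC := by
  intro G _ _ _ _ hG hsc
  letI : MeasurableSpace G := borel G
  haveI : BorelSpace G := ⟨rfl⟩
  intro r a ha hat hlb
  haveI : T2Space G := T2Space.of_injective_continuous r.injective r.continuous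
  haveI : SecondCountableTopology G :=
    (r.continuous.isClosedEmbedding r.injective).isEmbedding.secondCountableTopology
  obtain ⟨n, ε, hn, hε, hM, hrest⟩ := h G hG hsc r a ha hat hlb
  refine ⟨n, ε, hn, hε, hM, fun δ hδ => ?_⟩
  obtain ⟨T, β₂, hβ⟩ := hrest δ hδ
  refine ⟨T, β₂, fun β hb => ?_⟩
  obtain ⟨b, hb1, hlt, ℓ, T', Rs, E, hw⟩ := hβ β hb
  exact ⟨b, hb1, hlt, WorkingClass r.ρ ℓ T' Rs E, frameCovariant_workingClass r.ρ ℓ T' Rs E,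
    fun w hw' => ⟨typLocal_workingClass r.ρ r.continuous ℓ T' Rs E w, hw w hw'⟩⟩

/-- **(6b) ∧ R_NSC ⇒ IR (PROVED, E discharged, no X)** — lane A's done-when in the sharp currency. -/
theorem ir_of_workingClassSharpSC (h : WorkingClassSharpSC) (hN : IRNSC) :
    Summit.QuantumFields.YangMills.Theses.BalabanLadder.IR :=
  ir_of_clauseIAndRaritySharpSC (clauseIAndRaritySharpSC_of_workingClassSharpSC h) hN


/-! ## (6c) lane A's single-shell-cell influence number at a sharp mesh -/

/-- **(6c) Lane A's single-shell-cell influence number at a sharp mesh** (the hypothesis of the tree's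
`SingleCell.onsetMixingTypicalUKPcSC_of_singleCellWorkingClassSC` with `a β · b < T(δ)` added): rarity `δ` of the working class and, through
every rim-reaching cell union `Y ∋ 0` of the window, influence `≤ ε / shellCount n` on the centre-cell law of re-setting the links of ONE
shell cell, all other cells typical and fixed. -/
def SingleCellSharpSC : Prop :=
  ∀ (G : Type) [Group G] [TopologicalSpace G] [IsTopologicalGroup G] [CompactSpace G],
    IsCompactSimpleLieGroup G → SimplyConnectedSpace G →
    letI : MeasurableSpace G := borel G; haveI : BorelSpace G := ⟨rfl⟩;
    ∀ (r : LatticeRep G) (a : ℝ → ℝ), (∀ β, 0 < a β) → Tendsto a atTop (𝓝 0) → LowerBounds G r a →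
      ∃ (n : ℕ) (ε : ℝ), 1 ≤ n ∧ 0 ≤ ε ∧ ε * OnsetFormats.shellCount n ≤ 3 / 4 ∧
        ∀ δ : ℝ, 0 < δ → ∃ T β₂ : ℝ, ∀ β : ℝ, β₂ ≤ β → ∃ b : ℕ, 1 ≤ b ∧ a β * (b : ℝ) < T ∧
          ∃ (ℓ : ℕ) (T' : ℝ) (Rs : Set ℕ) (E : ℕ → ℝ), ∀ w : Fin 4 → ℤ → ℤ, OnsetFormatsUc.IsFrame b w →
            SupCellRarityAt r.ρ β w (WorkingClass r.ρ ℓ T' Rs E w) δ ∧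
            ∀ Y : Finset (Fin 4 → ℤ), Y ⊆ windowCells n → (0 : Fin 4 → ℤ) ∈ Y →
              ∀ c ∈ windowCellsPlus n \ windowCells n, ∀ ζ ζ' : LGConfig 4 G,
                (∀ c' ∈ windowCellsPlus n, c' ∉ Y →
                  ζ ∈ WorkingClass r.ρ ℓ T' Rs E w c' ∧ ζ' ∈ WorkingClass r.ρ ℓ T' Rs E w c') →
                (∀ e ∉ cellEdges w c, ζ e = ζ' e) →
                ∀ f : LGConfig 4 G → ℝ, IsCylinder f (cellEdges w 0) → Measurable f → (∀ U, 0 ≤ f U ∧ f U ≤ 1) →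
                  |(∫ U, f U ∂(ymSpecification r.ρ β (regionEdges w Y) ζ)) -
                    ∫ U, f U ∂(ymSpecification r.ρ β (regionEdges w Y) ζ')| ≤ ε / OnsetFormats.shellCount n

/-- **(6c) ⇒ (6b) (PROVED)** — the tree's telescoping `SingleCell.clauseI_of_singleShellCellInfluence` times `#shell = shellCount n`. -/
theorem workingClassSharpSC_of_singleCellSharpSC (h : SingleCellSharpSC) : WorkingClassSharpSC := by
  intro G _ _ _ _ hG hsc
  letI : MeasurableSpace G := borel G
  haveI : BorelSpace G := ⟨rfl⟩
  intro r a ha hat hlb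
  haveI : T2Space G := T2Space.of_injective_continuous r.injective r.continuous
  haveI : SecondCountableTopology G :=
    (r.continuous.isClosedEmbedding r.injective).isEmbedding.secondCountableTopology
  obtain ⟨n, ε, hn, hε, hM, hrest⟩ := h G hG hsc r a ha hat hlb
  refine ⟨n, ε, hn, hε, hM, fun δ hδ => ?_⟩
  obtain ⟨T, β₂, hβ⟩ := hrest δ hδ
  refine ⟨T, β₂, fun β hb => ?_⟩
  obtain ⟨b, hb1, hlt, ℓ, T', Rs, E, hw⟩ := hβ β hb
  refine ⟨b, hb1, hlt, ℓ, T', Rs, E, fun w hwf => ⟨?_, (hw w hwf).1⟩⟩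
  have hS0 : 0 < OnsetFormats.shellCount n := by
    unfold Summit.QuantumFields.YangMills.Cruxes.IR.OnsetFormats.shellCount
    have h7 : (4 * n + 1) ^ 4 < (4 * n + 3) ^ 4 := Nat.pow_lt_pow_left (by omega) (by norm_num)
    exact_mod_cast Nat.sub_pos_of_lt h7
  have hloc : ∀ c ∈ windowCellsPlus n,
      DependsOn (fun σ : LGConfig 4 G => σ ∈ WorkingClass r.ρ ℓ T' Rs E w c) ↑(cellEdges w c) :=
    fun c _ => (typLocal_workingClass r.ρ r.continuous ℓ T' Rs E w).2 c
  have key := clauseI_of_singleShellCellInfluence r.ρ r.continuous hb1 hwf hloc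
    (η := ε / OnsetFormats.shellCount n) (hw w hwf).2
  rwa [card_shell, mul_div_cancel₀ _ hS0.ne'] at key

/-- **(6c) ∧ R_NSC ⇒ IR (PROVED, E discharged, no X)** — lane A's located number in the sharp currency closes `IR|SC`. -/
theorem ir_of_singleCellSharpSC (h : SingleCellSharpSC) (hN : IRNSC) :
    Summit.QuantumFields.YangMills.Theses.BalabanLadder.IR :=
  ir_of_workingClassSharpSC (workingClassSharpSC_of_singleCellSharpSC h) hN


/-! ## (6d-wc) the relativised blocked-activity supplier, class = working class -/

/-- **(6d-wc) Lane (1)B's relativised supplier, abstract shape, class = working class (PROVED): adapter + sharp construction statement ⇒ `IR|SC` without X.**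
`Act ρ β w n r Typ` is ANY per-frame predicate («the mesh-`b` blocked specification on the frame `w` has polymer activities `≤ r` relative
to `Typ`-data» — lane (1)B's `BlockedActivityClass` relativised; its definition is theirs); `hadapt` is the relativised form of their
`univShellCond_of_blockedActivity` (activities `≤ r₀ n ε` ⇒ clause (i) at tolerance `ε` w.r.t. `Typ`, pure polymer combinatorics);
`hcons` is the CONSTRUCTION statement in the sharp currency (δ BEFORE `T, β₂`; mesh `a β · b < T`; class = the working class, whose rarity
conjunct is the explicit inequality `workingBudget ≤ δ`).  All research content sits in `hcons`. -/
theorem ir_of_activitySupplierSharpSC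
    (Act : ∀ {G : Type} [Group G] [TopologicalSpace G] [IsTopologicalGroup G] [CompactSpace G] [MeasurableSpace G]
      [BorelSpace G] {N : ℕ}, (G →* Matrix (Fin N) (Fin N) ℂ) → ℝ → (Fin 4 → ℤ → ℤ) → ℕ → ℝ →
        ((Fin 4 → ℤ) → Set (LGConfig 4 G)) → Prop)
    (r₀ : ℕ → ℝ → ℝ)
    (hadapt : ∀ {G : Type} [Group G] [TopologicalSpace G] [IsTopologicalGroup G] [CompactSpace G] [MeasurableSpace G]
      [BorelSpace G] {N : ℕ} (ρ : G →* Matrix (Fin N) (Fin N) ℂ) (β : ℝ) (w : Fin 4 → ℤ → ℤ) (n : ℕ) (ε : ℝ)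
      (Typ : (Fin 4 → ℤ) → Set (LGConfig 4 G)), Act ρ β w n (r₀ n ε) Typ → ClauseI ρ β w n ε Typ)
    (hcons : ∀ (G : Type) [Group G] [TopologicalSpace G] [IsTopologicalGroup G] [CompactSpace G],
      IsCompactSimpleLieGroup G → SimplyConnectedSpace G →
      letI : MeasurableSpace G := borel G; haveI : BorelSpace G := ⟨rfl⟩;
      ∀ (r : LatticeRep G) (a : ℝ → ℝ), (∀ β, 0 < a β) → Tendsto a atTop (𝓝 0) → LowerBounds G r a →
        ∃ (n : ℕ) (ε : ℝ), 1 ≤ n ∧ 0 ≤ ε ∧ ε * OnsetFormats.shellCount n ≤ 3 / 4 ∧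
          ∀ δ : ℝ, 0 < δ → ∃ T β₂ : ℝ, ∀ β : ℝ, β₂ ≤ β → ∃ b : ℕ, 1 ≤ b ∧ a β * (b : ℝ) < T ∧
            ∃ (ℓ : ℕ) (T' : ℝ) (Rs : Set ℕ) (E : ℕ → ℝ), ∀ w : Fin 4 → ℤ → ℤ, OnsetFormatsUc.IsFrame b w →
              Act r.ρ β w n (r₀ n ε) (WorkingClass r.ρ ℓ T' Rs E w) ∧
                SupCellRarityAt r.ρ β w (WorkingClass r.ρ ℓ T' Rs E w) δ)
    (hN : IRNSC) : Summit.QuantumFields.YangMills.Theses.BalabanLadder.IR := by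
  refine ir_of_workingClassSharpSC (fun G _ _ _ _ hG hsc => ?_) hN
  letI : MeasurableSpace G := borel G
  haveI : BorelSpace G := ⟨rfl⟩
  intro r a ha hat hlb
  obtain ⟨n, ε, hn, hε, hM, hrest⟩ := hcons G hG hsc r a ha hat hlb
  refine ⟨n, ε, hn, hε, hM, fun δ hδ => ?_⟩
  obtain ⟨T, β₂, hβ⟩ := hrest δ hδ
  refine ⟨T, β₂, fun β hb => ?_⟩
  obtain ⟨b, hb1, hlt, ℓ, T', Rs, E, hw⟩ := hβ β hb
  exact ⟨b, hb1, hlt, ℓ, T', Rs, E, fun w hwf => ⟨hadapt r.ρ β w n ε _ (hw w hwf).1, (hw w hwf).2⟩⟩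

end Summit.QuantumFields.YangMills.Cruxes.IR.AfPincerUc.SharpOnset

end
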